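import Summits.BirchSwinnertonDyer.BirchSwinnertonDyer.Theorems.BiquadraticEisensteinDescentManinDatumSupercuspidalCMInertThetaValueAssemblyJZero
import Summits.BirchSwinnertonDyer.BirchSwinnertonDyer.Theorems.BiquadraticEisensteinDescentManinDatumSupercuspidalCMInertSexticModelPeriods
import HarnessLib

set_option linter.dupNamespace false -- `Summit.BirchSwinnertonDyer.BirchSwinnertonDyer.Theorems.…` (summit = sub, D-0017)
set_option autoImplicit false

/-!
# Crux `ManinDatumSupercuspidalCMInert` (stmt-BirchSwinnertonDyer-20111, BED r605), stub `stub_S5` (`j = 0` at `p = 5`) — ASSEMBLY LANE,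
# `j = 0` twin of `…ThetaValueAssembly` §§4–5 / `…ModelLValuesOfTorsionIntegral`: the `f`-free odd twisted `L`-value `5`-integrality of the
# Mordell model `E^k : y² = x³ + k` (`5 ∣ k`) from a sextic theta dictionary modulo `5M′`, and hypothesis `H₅` of `…StubsOfModelLValues`
# from the dictionary packaged over the range of `H₅` (width seat `bsd-wall-cm-bed-w3` g11; theorems only; `--supports 20111`, helper)

Route `BiquadraticEisensteinDescent` (cell `pub/bsd-wall`), S5-road item D4-B. Inputs, all PROVED in the tree:
* D4-A ★ `…ThetaValueAssemblyJZero.sum_classes_integral_of_character` (this seat): the finite Eisenstein sum of `𝒪₃` modulo `5M′` with weight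
  `W = Φ ⊗ Ψ` is `5`-integral after division by `ϖ₁·5^{(6−k)/6}` (from bed-w1 g8's CM core `core_rho_of_character`);
* the finite formula `QuadOrder.thetaLFunction_parityLift_one` (Rubin Prop. 7.15 at `k = 1` on `𝒪₃`);
* the period side ★ `…SexticModelPeriods.exists_imaginaryPeriodRat_sextic` (bed-w1 g8, p648200): `Ω⁻(E^k) = c·ϖ₁·|k|^{−1/6}`, `c ∈ {1, √3}`,
  `3/c ∈ ℤ̄`; `|k|^{1/6} = 5^{e/6}k₁^{1/6}` (`inv_abs_rpow_neg_sixth_of_eq`), `5^{e/6}·5^{(6−e)/6} = 5` (`natCast_cpow_sixth_mul_cpow_sixth_of_le`).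

Contents:
* §1 `weight_periodic`, `thetaLFunction_parityLift_one_integral_of_character` — `W♯`-theta value: `s·((2·5M′)·Θ-L_{3,2·5M′}(W♯)(1))/(ϖ₁5^{(6−k)/6}) ∈ ℤ̄`;
* §2 ★ `oddLValue_sextic_of_dictionary` — for `k ≠ 0`, `|k| = 5^e·k₁`, `1 ≤ e ≤ 5`, `(5, M′) = 1`, `Φ` with the five axioms of `(·/5)₆^e`
  (bed-w1 g8's orientation `Φ(ρd) = ρ^eΦ(d)`), `Ψ` periodic modulo `M′` with algebraic-integer values, `W(y) = Φ(y₂, y₁ + y₂)Ψ(y)`, an ENTIRE `L`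
  agreeing with `Σ χ̄(n)a_n(E^k)n⁻ˢ` on `re s > 2` and with `L(1) = (u/N)·Θ-L_{3,2·5M′}(W♯)(1)` (`u ∈ ℤ̄`, `5 ∤ N` — the DICTIONARY, bed-w2 g11's
  D3 at `s = 1`): `∃ s, 5 ∤ s ∧ s·τ(χ)·L(1)/(i·Ω⁻(E^k)) ∈ ℤ̄`. Bookkeeping: `s := 6·N·s₀·M′`,
  `6Ns₀M′·τ·(u/N)Θ(1)/(i·cϖ₁5^{−e/6}k₁^{−1/6}) = (−i)(3/c)·τ·u·k₁^{1/6}·[s₀(10M′Θ(1))/(ϖ₁5^{(6−e)/6})]` using `5^{e/6}5^{(6−e)/6} = 5`;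
* §3 ★ `H5_of_sexticDictionary` — hypothesis `H₅` of `…StubsOfModelLValues` / `…OfH5.maninDatumSupercuspidalCMInert_of_H5` (VERBATIM) from the
  dictionary packaged existentially over `H₅`'s range `(k, ℓ, χ)` (`hdictAll`, the target of bed-w2 g11's `SexticTwistThetaDictionary` (iii)).

HONEST FRAMING: the dictionary `hdictAll` is NOT proved here (bed-w2 g11's D3); nothing here proves the stub, the crux, Manin's conjecture or
BSD. No definition, no named fact, no `sorry`; axioms standard. [cite: Rubin1999, §7.4 Prop. 7.15] [cite: MazurTateTeitelbaum1986, §I.8 (8.6)]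
-/

noncomputable section

open scoped Classical
open Complex PeriodPair
open Literature.NumberTheory.EllipticCurves
open Literature.NumberTheory.LFunctions

namespace Summit.BirchSwinnertonDyer.BirchSwinnertonDyer.Theorems.BiquadraticEisensteinDescentManinDatumSupercuspidalCMInertModelLValuesSexticOfDictionary

open Summit.BirchSwinnertonDyer.BirchSwinnertonDyer.Theorems.BiquadraticEisensteinDescentManinDatumSupercuspidalCMInertThetaValueAssemblyJZero
  (sum_classes_integral_of_character)
open Summit.BirchSwinnertonDyer.BirchSwinnertonDyer.Theorems.BiquadraticEisensteinDescentManinDatumSupercuspidalCMInertSexticModelPeriods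
  (exists_imaginaryPeriodRat_sextic isIntegral_rpow_sixth inv_abs_rpow_neg_sixth_of_eq natCast_cpow_sixth_mul_cpow_sixth_of_le)
open Summit.BirchSwinnertonDyer.BirchSwinnertonDyer.Theorems.BiquadraticEisensteinDescentManinDatumSupercuspidalCMInertFiveDivisionEisensteinJZero
  (varpiRho_pos)

/-! ## §1 The theta `L`-value of `𝒪₃` at `s = 1` with weight `W♯` -/

section Theta

variable {M' : ℕ} [NeZero M']
variable {k : ℕ} (Φ : ZMod 5 × ZMod 5 → ℂ) (hΦ0 : Φ 0 = 0) (hΦone : Φ (0, 1) = 1) (hΦneg : ∀ d, Φ (-d) = Φ d)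
  (hΦrho : ∀ d : ZMod 5 × ZMod 5, Φ (d.2 - d.1, -d.1) = (UpperHalfPlane.ρ : ℂ) ^ k * Φ d)
  (hΦgen : ∀ d : ZMod 5 × ZMod 5, Φ (2 * d.1 - d.2, d.1 + d.2) = (-(UpperHalfPlane.ρ : ℂ) ^ 2) ^ k * Φ d)
  (Ψ W : ℤ × ℤ → ℂ) (hΨ : ∀ y z : ℤ × ℤ, Ψ (y.1 + M' * z.1, y.2 + M' * z.2) = Ψ y)
  (hΨint : ∀ y : ℤ × ℤ, IsIntegral ℤ (Ψ y))
  (hW : ∀ y : ℤ × ℤ, W y = Φ ((y.2 : ZMod 5), ((y.1 + y.2 : ℤ) : ZMod 5)) * Ψ y)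
include hΦ0 hΦone hΦneg hΦrho hΦgen hΨ hΨint hW

omit [NeZero M'] hΦ0 hΦone hΦneg hΦrho hΦgen hΨint in
/-- `W = Φ ⊗ Ψ` is periodic modulo `5M′`. [folklore] -/
theorem weight_periodic (y z : ℤ × ℤ) : W (y.1 + (5 * M' : ℕ) * z.1, y.2 + (5 * M' : ℕ) * z.2) = W y := by
  have h5 : (5 : ZMod 5) = 0 := by decide
  have eΦ : ((((y.2 + (5 * M' : ℕ) * z.2 : ℤ) : ZMod 5), (((y.1 + (5 * M' : ℕ) * z.1) + (y.2 + (5 * M' : ℕ) * z.2) : ℤ) : ZMod 5)) :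
      ZMod 5 × ZMod 5) = (((y.2 : ℤ) : ZMod 5), ((y.1 + y.2 : ℤ) : ZMod 5)) := by
    ext
    · push_cast; rw [h5]; ring
    · push_cast; rw [h5]; ring
  have eΨ : Ψ (y.1 + (5 * M' : ℕ) * z.1, y.2 + (5 * M' : ℕ) * z.2) = Ψ y := by
    have h := hΨ y (5 * z.1, 5 * z.2)
    simp only at h
    have e1 : y.1 + ((5 * M' : ℕ) : ℤ) * z.1 = y.1 + (M' : ℤ) * (5 * z.1) := by push_cast; ring
    have e2 : y.2 + ((5 * M' : ℕ) : ℤ) * z.2 = y.2 + (M' : ℤ) * (5 * z.2) := by push_cast; ring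
    rw [e1, e2, h]
  rw [hW, hW y]
  dsimp only
  rw [eΦ, eΨ]

/-- ★ **The same for the weight-one theta `L`-value of `𝒪₃` at `s = 1`** (finite formula `QuadOrder.thetaLFunction_parityLift_one`):
`s · ((2·5M′) · Θ-L_{3, 2·5M′}(W♯)(1)) / (ϖ₁ · 5^{(6−k)/6}) ∈ ℤ̄` for some `5 ∤ s`. [cite: Rubin1999, §7.4 Prop. 7.15] -/
theorem thetaLFunction_parityLift_one_integral_of_character (hk1 : 1 ≤ k) (hk5 : k ≤ 5) (hcop : Nat.Coprime 5 M') :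
    ∃ s : ℕ, ¬ 5 ∣ s ∧ IsIntegral ℤ ((s : ℂ) *
      (((2 * (5 * M') : ℕ) : ℂ) * BinaryTheta.thetaLFunction 3 (2 * (5 * M')) 1 (-((Real.sqrt (3 : ℕ) : ℂ) * I))
        (QuadOrder.parityLift W) 1) /
      ((((2 : ℝ) ^ (2 / 3 : ℝ) * Real.Gamma (1 / 3) ^ 3 / (4 * Real.pi) : ℝ) : ℂ) * (5 : ℂ) ^ (((6 - k : ℕ) : ℂ) / 6))) := by
  haveI : NeZero (5 * M') := inferInstance
  have hN : ((2 * (5 * M') : ℕ) : ℂ) ≠ 0 := Nat.cast_ne_zero.mpr (NeZero.ne _)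
  rw [QuadOrder.thetaLFunction_parityLift_one 3 (5 * M') W (weight_periodic Φ Ψ W hΨ hW),
    ← mul_assoc, mul_inv_cancel₀ hN, one_mul]
  exact sum_classes_integral_of_character Φ hΦ0 hΦone hΦneg hΦrho hΦgen Ψ W hΨ hΨint hW hk1 hk5 hcop

end Theta

/-! ## §2 ★ The `f`-free odd statement for `E^k : y² = x³ + k` modulo the sextic theta dictionary -/

section Final

/-- `¬ 5 ∣ 6`. [folklore] -/
theorem not_five_dvd_six : ¬ 5 ∣ 6 := by decide

/-- ★ **The `f`-free odd twisted-value statement for `E^k : y² = x³ + k` at `5`, MODULO the sextic theta dictionary.** Let `k ≠ 0` with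
`|k| = 5^e·k₁`, `1 ≤ e ≤ 5`, `(5, M′) = 1`, `Φ : (ℤ/5)² → ℂ` with the five axioms of `(·/5)₆^e` (orientation `Φ(ρd) = ρ^eΦ(d)`), `Ψ` periodic
modulo `M′` with algebraic-integer values, `W(y) = Φ(y₂, y₁ + y₂)Ψ(y)` on `𝒪₃ ∋ y₁ + y₂ω₃`; let `L` be entire with
`L(s) = Σ χ̄(n)a_n(E^k)n⁻ˢ` for `re s > 2` and (DICTIONARY at `s = 1`) `L(1) = (u/N)·Θ-L_{3, 2·5M′}(W♯)(1)`, `u ∈ ℤ̄`, `5 ∤ N`. Then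
`s·τ(χ)·L(1)/(i·Ω⁻(E^k)) ∈ ℤ̄` for some `5 ∤ s`. Period side: `Ω⁻(E^k) = cϖ₁|k|^{−1/6}`, `c ∈ {1, √3}` (bed-w1 g8); value side: §1 (bed-w1 g8's CM
core through D4-A); the powers of `5` cancel exactly: `5^{e/6}·5^{(6−e)/6} = 5` against the `1/(2·5M′)` of the finite formula.
[cite: Rubin1999, §7.4 Prop. 7.15] [cite: MazurTateTeitelbaum1986, §I.8 (8.6)] -/
theorem oddLValue_sextic_of_dictionary (k : ℤ) (hk : k ≠ 0) {e : ℕ} (he1 : 1 ≤ e) (he5 : e ≤ 5) {k₁ : ℕ} (hke : k.natAbs = 5 ^ e * k₁)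
    {m : ℕ} [NeZero m] (χ : DirichletCharacter ℂ m) {M' : ℕ} [NeZero M'] (hcop : Nat.Coprime 5 M')
    (Φ : ZMod 5 × ZMod 5 → ℂ) (hΦ0 : Φ 0 = 0) (hΦone : Φ (0, 1) = 1) (hΦneg : ∀ d, Φ (-d) = Φ d)
    (hΦrho : ∀ d : ZMod 5 × ZMod 5, Φ (d.2 - d.1, -d.1) = (UpperHalfPlane.ρ : ℂ) ^ e * Φ d)
    (hΦgen : ∀ d : ZMod 5 × ZMod 5, Φ (2 * d.1 - d.2, d.1 + d.2) = (-(UpperHalfPlane.ρ : ℂ) ^ 2) ^ e * Φ d)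
    (Ψ W : ℤ × ℤ → ℂ) (hΨ : ∀ y z : ℤ × ℤ, Ψ (y.1 + M' * z.1, y.2 + M' * z.2) = Ψ y)
    (hΨint : ∀ y : ℤ × ℤ, IsIntegral ℤ (Ψ y))
    (hW : ∀ y : ℤ × ℤ, W y = Φ ((y.2 : ZMod 5), ((y.1 + y.2 : ℤ) : ZMod 5)) * Ψ y)
    (L : ℂ → ℂ) (hLdiff : Differentiable ℂ L)
    (hL : ∀ s : ℂ, 2 < s.re →
      L s = LSeries (fun n : ℕ ↦ χ⁻¹ (n : ZMod m) * ((⟨0, 0, 0, 0, (k : ℚ)⟩ : WeierstrassCurve ℚ).LFunction n : ℂ)) s)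
    {u : ℂ} (hu : IsIntegral ℤ u) {N : ℕ} (hN : ¬ 5 ∣ N)
    (hL1 : L 1 = u / N * BinaryTheta.thetaLFunction 3 (2 * (5 * M')) 1 (-((Real.sqrt (3 : ℕ) : ℂ) * I))
      (QuadOrder.parityLift W) 1) :
    ∃ L : ℂ → ℂ, Differentiable ℂ L ∧
      (∀ s : ℂ, 2 < s.re →
        L s = LSeries (fun n : ℕ ↦ χ⁻¹ (n : ZMod m) * ((⟨0, 0, 0, 0, (k : ℚ)⟩ : WeierstrassCurve ℚ).LFunction n : ℂ)) s) ∧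
      ∃ s : ℕ, ¬ 5 ∣ s ∧ IsIntegral ℤ ((s : ℂ) * (gaussSum χ (ZMod.stdAddChar (N := m)) * L 1 /
        (Complex.I * ((⟨0, 0, 0, 0, (k : ℚ)⟩ : WeierstrassCurve ℚ).imaginaryPeriodRat : ℂ)))) := by
  refine ⟨L, hLdiff, hL, ?_⟩
  haveI : NeZero (5 * M') := inferInstance
  have hM5 : ¬ 5 ∣ M' := fun h ↦ by
    have h1 : 5 ∣ Nat.gcd 5 M' := Nat.dvd_gcd (dvd_refl 5) h
    rw [hcop] at h1
    omega
  have hN0 : N ≠ 0 := by rintro rfl; exact hN (dvd_zero 5)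
  -- the value side
  obtain ⟨s₀, hs₀, hX⟩ :=
    thetaLFunction_parityLift_one_integral_of_character Φ hΦ0 hΦone hΦneg hΦrho hΦgen Ψ W hΨ hΨint hW he1 he5 hcop
  set Θ : ℂ := BinaryTheta.thetaLFunction 3 (2 * (5 * M')) 1 (-((Real.sqrt (3 : ℕ) : ℂ) * I)) (QuadOrder.parityLift W) 1 with hΘ
  set ϖ : ℂ := (((2 : ℝ) ^ (2 / 3 : ℝ) * Real.Gamma (1 / 3) ^ 3 / (4 * Real.pi) : ℝ) : ℂ) with hϖ
  set ρ' : ℂ := (5 : ℂ) ^ (((6 - e : ℕ) : ℂ) / 6) with hρ'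
  set X : ℂ := (s₀ : ℂ) * (((2 * (5 * M') : ℕ) : ℂ) * Θ) / (ϖ * ρ') with hXdef
  -- the period side
  obtain ⟨c, hc0, hcint, hΩ⟩ := exists_imaginaryPeriodRat_sextic k hk
  have hk₁0 : k₁ ≠ 0 := by
    rintro rfl
    rw [mul_zero, Int.natAbs_eq_zero] at hke
    exact hk hke
  have hinv := inv_abs_rpow_neg_sixth_of_eq hke
  set t : ℂ := ((5 : ℕ) : ℂ) ^ ((e : ℂ) / 6) with ht
  set a : ℂ := ((((k₁ : ℝ) ^ (1 / 6 : ℝ) : ℝ)) : ℂ) with ha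
  have hX' : ((((|(k : ℝ)| ^ (-(1 / 6 : ℝ)) : ℝ)) : ℂ)) = (t * a)⁻¹ := by rw [← hinv, inv_inv]
  set τ : ℂ := gaussSum χ (ZMod.stdAddChar (N := m)) with hτ
  refine ⟨6 * N * s₀ * M', ?_, ?_⟩
  · intro h
    rcases (Nat.Prime.dvd_mul (by norm_num : (5 : ℕ).Prime)).mp h with h | h
    · rcases (Nat.Prime.dvd_mul (by norm_num : (5 : ℕ).Prime)).mp h with h | h
      · rcases (Nat.Prime.dvd_mul (by norm_num : (5 : ℕ).Prime)).mp h with h | h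
        · exact not_five_dvd_six h
        · exact hN h
      · exact hs₀ h
    · exact hM5 h
  rw [hL1, hΩ, Complex.ofReal_mul, Complex.ofReal_mul, hX']
  have hϖ0 : ϖ ≠ 0 := Complex.ofReal_ne_zero.mpr varpiRho_pos.ne'
  have hρ0 : ρ' ≠ 0 := by
    intro h; have := (Complex.cpow_eq_zero_iff _ _).mp h; exact (by norm_num : (5 : ℂ) ≠ 0) this.1
  have ht0 : t ≠ 0 := by
    intro h; have := (Complex.cpow_eq_zero_iff _ _).mp h; exact (by norm_num : ((5 : ℕ) : ℂ) ≠ 0) this.1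
  have ha0 : a ≠ 0 := Complex.ofReal_ne_zero.mpr (Real.rpow_pos_of_pos (by exact_mod_cast Nat.pos_of_ne_zero hk₁0) _).ne'
  have htρ : t * ρ' = 5 := by
    have h := natCast_cpow_sixth_mul_cpow_sixth_of_le (q := 5) (by norm_num) (e := e) (by omega)
    rw [ht, hρ']
    exact_mod_cast h
  have hcC : (c : ℂ) ≠ 0 := Complex.ofReal_ne_zero.mpr hc0
  have hM : (M' : ℂ) ≠ 0 := Nat.cast_ne_zero.mpr (NeZero.ne M')
  have hNC : (N : ℂ) ≠ 0 := Nat.cast_ne_zero.mpr hN0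
  have hs0C : (s₀ : ℂ) ≠ 0 := by
    have : s₀ ≠ 0 := by rintro rfl; exact hs₀ (dvd_zero 5)
    exact Nat.cast_ne_zero.mpr this
  have key : ((6 * N * s₀ * M' : ℕ) : ℂ) * (τ * (u / N * Θ) / (I * ((c : ℂ) * (ϖ * (t * a)⁻¹)))) =
      (-I) * ((3 : ℂ) / c) * τ * u * a * X := by
    rw [hXdef]
    push_cast
    field_simp
    linear_combination (6 * τ * u * Θ) * htρ + (30 * τ * u * Θ) * I_sq
  rw [key]
  have hI : IsIntegral ℤ (-I : ℂ) := by
    refine IsIntegral.of_pow (n := 2) (by norm_num) ?_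
    rw [neg_sq, I_sq]; exact isIntegral_one.neg
  exact ((((hI.mul hcint).mul (StarredOptimalManinUnitFiveSevenValueExit.isIntegral_gaussSum χ)).mul hu).mul
    (isIntegral_rpow_sixth k₁)).mul hX

end Final

/-! ## §3 ★ Hypothesis `H₅` from the sextic theta dictionary packaged over its range -/

/-- ★ **`H₅` from the sextic theta dictionary.** If for every sixth-power-free `k ≠ 0` with `5 ∣ k`, every prime `ℓ ≥ 5` with `ℓ ∤ k`,
`ℓ ≢ 1 (4)`, `ℓ ≢ 1 (5)`, `5` a square mod `ℓ`, and every odd character `χ` mod `ℓ`, the E-side supplies the DICTIONARY DATA — `e = v₅`-exponent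
with `|k| = 5^e k₁`, `1 ≤ e ≤ 5`; a modulus `M′` prime to `5`; the `5`-part `Φ : (ℤ/5)² → ℂ` with the five axioms of `(·/5)₆^e`; the prime-to-`5`
weight `Ψ` (periodic modulo `M′`, algebraic-integer values); `W = Φ ⊗ Ψ`; an entire `L` agreeing with `Σ χ̄(n)a_n(E^k)n⁻ˢ` on `re s > 2` and with
`L(1) = (u/N)·Θ-L_{3,2·5M′}(W♯)(1)`, `u ∈ ℤ̄`, `5 ∤ N` — then hypothesis `H₅` of `…StubsOfModelLValues.maninDatumSupercuspidalCMInert_of_modelOddLValues`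
(equivalently of `…OfH5.maninDatumSupercuspidalCMInert_of_H5`) holds VERBATIM. [cite: Rubin1999, §7.4 Prop. 7.15] [cite: IrelandRosen1990, Ch. 18 §7] -/
theorem H5_of_sexticDictionary
    (hdictAll : ∀ (k : ℤ), k ≠ 0 → (5 : ℤ) ∣ k → (∀ q : ℕ, q.Prime → ¬ ((q : ℤ) ^ 6 ∣ k)) →
      ∀ (ℓ : ℕ) [NeZero ℓ], ℓ.Prime → 5 ≤ ℓ → ¬ (ℓ : ℤ) ∣ k → ¬ 4 ∣ ℓ - 1 → ¬ 5 ∣ ℓ - 1 →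
        IsSquare ((5 : ℕ) : ZMod ℓ) →
      ∀ χ : DirichletCharacter ℂ ℓ, χ.Odd →
      ∃ (e k₁ M' : ℕ) (_ : NeZero M') (Φ : ZMod 5 × ZMod 5 → ℂ) (Ψ W : ℤ × ℤ → ℂ) (L : ℂ → ℂ) (u : ℂ) (N : ℕ),
        1 ≤ e ∧ e ≤ 5 ∧ k.natAbs = 5 ^ e * k₁ ∧ Nat.Coprime 5 M' ∧
        Φ 0 = 0 ∧ Φ (0, 1) = 1 ∧ (∀ d, Φ (-d) = Φ d) ∧
        (∀ d : ZMod 5 × ZMod 5, Φ (d.2 - d.1, -d.1) = (UpperHalfPlane.ρ : ℂ) ^ e * Φ d) ∧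
        (∀ d : ZMod 5 × ZMod 5, Φ (2 * d.1 - d.2, d.1 + d.2) = (-(UpperHalfPlane.ρ : ℂ) ^ 2) ^ e * Φ d) ∧
        (∀ y z : ℤ × ℤ, Ψ (y.1 + M' * z.1, y.2 + M' * z.2) = Ψ y) ∧ (∀ y : ℤ × ℤ, IsIntegral ℤ (Ψ y)) ∧
        (∀ y : ℤ × ℤ, W y = Φ ((y.2 : ZMod 5), ((y.1 + y.2 : ℤ) : ZMod 5)) * Ψ y) ∧
        Differentiable ℂ L ∧
        (∀ s : ℂ, 2 < s.re →
          L s = LSeries (fun n : ℕ ↦ χ⁻¹ (n : ZMod ℓ) * ((⟨0, 0, 0, 0, (k : ℚ)⟩ : WeierstrassCurve ℚ).LFunction n : ℂ)) s) ∧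
        IsIntegral ℤ u ∧ ¬ 5 ∣ N ∧
        L 1 = u / N * BinaryTheta.thetaLFunction 3 (2 * (5 * M')) 1 (-((Real.sqrt (3 : ℕ) : ℂ) * I))
          (QuadOrder.parityLift W) 1) :
    ∀ (k : ℤ), k ≠ 0 → (5 : ℤ) ∣ k → (∀ q : ℕ, q.Prime → ¬ ((q : ℤ) ^ 6 ∣ k)) →
      ∀ (ℓ : ℕ) [NeZero ℓ], ℓ.Prime → 5 ≤ ℓ → ¬ (ℓ : ℤ) ∣ k → ¬ 4 ∣ ℓ - 1 → ¬ 5 ∣ ℓ - 1 →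
        IsSquare ((5 : ℕ) : ZMod ℓ) →
      ∀ χ : DirichletCharacter ℂ ℓ, χ.Odd →
      ∃ L : ℂ → ℂ, Differentiable ℂ L ∧
        (∀ s : ℂ, 2 < s.re → L s = LSeries (fun n : ℕ ↦ χ⁻¹ (n : ZMod ℓ) *
          ((⟨0, 0, 0, 0, (k : ℚ)⟩ : WeierstrassCurve ℚ).LFunction n : ℂ)) s) ∧
        ∃ s : ℕ, ¬ 5 ∣ s ∧ IsIntegral ℤ ((s : ℂ) * (gaussSum χ (ZMod.stdAddChar (N := ℓ)) * L 1 /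
          (Complex.I * ((⟨0, 0, 0, 0, (k : ℚ)⟩ : WeierstrassCurve ℚ).imaginaryPeriodRat : ℂ)))) := by
  intro k hk h5k h6 ℓ _ hℓ h5ℓ hℓk h4 h5 hsq χ hχ
  obtain ⟨e, k₁, M', _, Φ, Ψ, W, L, u, N, he1, he5, hke, hcop, hΦ0, hΦone, hΦneg, hΦrho, hΦgen, hΨ, hΨint, hW, hLdiff, hL,
    hu, hN, hL1⟩ := hdictAll k hk h5k h6 ℓ hℓ h5ℓ hℓk h4 h5 hsq χ hχ
  exact oddLValue_sextic_of_dictionary k hk he1 he5 hke χ hcop Φ hΦ0 hΦone hΦneg hΦrho hΦgen Ψ W hΨ hΨint hW L hLdiff hL hu hN hL1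

end Summit.BirchSwinnertonDyer.BirchSwinnertonDyer.Theorems.BiquadraticEisensteinDescentManinDatumSupercuspidalCMInertModelLValuesSexticOfDictionary

end
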